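import Literature.MathematicalPhysics.QuantumFieldTheory.ConformalBootstrap3D.PointKernelK34L505Data
import Literature.MathematicalPhysics.QuantumFieldTheory.ConformalBootstrap3D.PointKernelK34L505Segs
import Literature.MathematicalPhysics.QuantumFieldTheory.ConformalBootstrap3D.PointKernelParts

/-!
# K34L505 certificate, kernel part file P6: one-cell head segments 54, 55 in level ranges

The head cells whose kernel evaluation exceeds one `decide` are one-cell segments of `hsegsK34L505`; each is
checked by `PCert.hPartSideOK` (side conditions) and `PCert.hPartOK` per level range `[n_lo, n_lo + count)`
against an integer claim, the claims summing to `≥ 0` (`PointKernel.partsOK`); soundness is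
`PCert.hParts_sound` (`PointKernelParts`).  The part files are mutually independent (each imports only
the data file); the ranges of one cell may span several of them, and the per-cell conclusions
`hparts_i` / `hcell_i` of those cells are assembled in `PointKernelK34L505.lean`.
Estimated kernel time 221 s.
-/

set_option maxRecDepth 100000
set_option maxHeartbeats 0

namespace Literature.MathematicalPhysics.QuantumFieldTheory.ConformalBootstrap3D.PointKernelK34L505

open Literature.MathematicalPhysics.QuantumFieldTheory.ConformalBootstrap3D.PointKernel

/-- levels `[49, 56)` of segment 54: partial lower sum `≥` claim. [folklore] -/
theorem part_54_3 : certK34L505.hPartOK (PCert.segAt hsegsK34L505 54) JHK34L505 49 7 (153926490703024744600666660651060063) = true := by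
  decide +kernel

/-- levels `[56, 61)` of segment 54: partial lower sum `≥` claim. [folklore] -/
theorem part_54_4 : certK34L505.hPartOK (PCert.segAt hsegsK34L505 54) JHK34L505 56 5 (53000534566037409417352421747095994) = true := by
  decide +kernel

/-- levels `[61, 66)` of segment 54: partial lower sum `≥` claim. [folklore] -/
theorem part_54_5 : certK34L505.hPartOK (PCert.segAt hsegsK34L505 54) JHK34L505 61 5 (28867254959443430769040298166535978) = true := by
  decide +kernel

/-- levels `[66, 67)` of segment 54: partial lower sum `≥` claim. [folklore] -/
theorem part_54_6 : certK34L505.hPartOK (PCert.segAt hsegsK34L505 54) JHK34L505 66 1 (2496378298001211442122988400974420) = true := by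
  decide +kernel

/-- one-cell segment 55 (row 4, cell `[20481/4096, 10241/2048]`, chord, `n_F = 66`,
7 level ranges): side conditions. [folklore] -/
theorem pside_55 : certK34L505.hPartSideOK (PCert.segAt hsegsK34L505 55) JHK34L505 = true := by
  decide +kernel

/-- its level ranges `(n_lo, count, claim)`. [folklore] -/
def partsK34L505_55 : List (ℕ × ℕ × ℤ) := [(0, 29, -2465300869688654780021855229425346962), (29, 12, 1807295390843351645004905962271036581), (41, 8, 418386779316604198745184648239784625), (49, 7, 153833633207105531830426354161460465), (56, 5, 53349103550916814696315990356597209), (61, 5, 29328613048999806562168445919473527), (66, 1, 3107349721676783182853828476994559)]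

/-- the ranges tile `[0, n_F]` and the claims sum to `≥ 0`. [folklore] -/
theorem pcov_55 : PointKernel.partsOK 66 partsK34L505_55 = true := by
  decide +kernel

end Literature.MathematicalPhysics.QuantumFieldTheory.ConformalBootstrap3D.PointKernelK34L505
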